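import Summits.BirchSwinnertonDyer.BirchSwinnertonDyer.Theorems.AlignedTransportAtTwoMainConjectureOfRankZeroBSDAtTwoHalfDescentValues
import HarnessLib

/-!
# Route `AlignedTransportAtTwo`, crux C2 `MainConjectureOfRankZeroBSDAtTwo` (stmt-BirchSwinnertonDyer-22298):
# THE HALF-DEGREE DESCENT, IV: THE TWIST ZERO — with NO parity hypothesis, the distinguished polynomial of an `ι`-stable `F ∈ ℤ_p⟦T⟧`
# (`F ≢ 0 (mod p)`, `F(0) ≠ 0`) is `P = (T + 2)^k · (1+T)^m · h(γ + γ⁻¹)`, `k = ord_{T = −2} P`, `λ = k + 2m`, `h` monic of degree `m` unique;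
# so `F = p^μ (T+2)^k h(γ + γ⁻¹)·w` and `|F(ζ − 1)| = p^{−μ} |ζ + 1|^k |h(ζ + ζ⁻¹)|` (at `p` odd, `k = 0`)

HONEST FRAMING (cell `bsd-f1-sign2`, WIDTH-5 attached prover seat `bsd-line-att-p5` gen 51 on line `birth` of the lead `bsd-line-att-p2`;
`--supports` stmt-BirchSwinnertonDyer-22298, closes nothing; BSD is NOT proved by any of this; the crux C2, its verdict «blocked-on
`Rank1Residual.GreenbergMuConjectureIrreducible`» and every registered stub are untouched). THEOREMS ONLY — no `def`, no instance, no named fact,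
no `sorry`; pure algebra. Sequel of `…HalfDescent` (p824762) / `…HalfDescentValues` (p824853), which assumed `λ` even (at `p = 2`: `F(−2) ≠ 0`).

THE POINT. The second `ι`-fixed point of the disc is `T = −2` (`γ = −1`; at `p = 2` the `χ₈`-twist, g38/g49), and `T + 2` is `ι`-stable:
`(1+T)·ι(T+2) = T + 2` (`one_add_X_mul_invol_X_add_two`). Peeling off the exact power `(T+2)^k`, `k = ord_{−2} P` (Mathlib `rootMultiplicity`), leaves
an `ι`-palindromic `P'` with `P'(−2) ≠ 0` (`invol_divByMonic_pow`), hence of EVEN degree (`eval_neg_two_eq_zero_of_reciprocal_eq_of_odd`: a reciprocal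
identity `Q_d(P') = P'` of odd degree forces `P'(−2) = 0`), to which the half-descent applies:
* ★★★ `exists_twistZero_realCounterpart`: `F ≢ 0 (mod p)`, `F(0) ≠ 0`, `ι F = uF` ⟹ with `k := ord_{−2} P`, **`λ = k + 2m`** and there is a monic `h` of
  degree `m` with **`P = (T + 2)^k · ∑ b_j (1+T)^{m−j}((1+T)²+1)^j`**, i.e. `P = (T+2)^k (1+T)^m h(γ + γ⁻¹)`; `h` is unique (`realCounterpart_unique_of_twistZero`).
* ★★ `eval₂_sub_one_eq_of_twistZero`: **`P(x − 1) = (x + 1)^k · x^m · h(x + x⁻¹)`** for every unit `x` of every algebra.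
* ★★ `coe_eq_of_twistZero`: in `Λ`, `P = (T+2)^k (1+T)^m h(γ + γ⁻¹)`; ★★★ `exists_eq_C_pow_mu_mul_X_add_two_pow_mul_aeval_mul_unit`:
  **`F = p^{μ(F)} · (T+2)^k · h(γ + γ⁻¹) · w`**, `w ∈ Λˣ` — at `p = 2`: `char_Λ X(W/ℚ_∞)` of ANY class of the cell (twin value `0` allowed, i.e. `W⁽²⁾` of
  positive rank under MC) is `2^μ (T+2)^k h(γ+γ⁻¹)`: three invariants `(μ, k, h)`, `λ = k + 2·deg h`, `λ ≡ k (mod 2)` (Matsuno's parity).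
At odd `p`, `k = 0` (`T + 2` is a unit: `rootMultiplicity_neg_two_eq_zero_of_odd_prime`). BSD is not proved by any of this; nothing about any curve is asserted.
Memo `Cruxes/MainConjectureOfRankZeroBSDAtTwo/HALF-DESCENT-att-p5-g51.md`.

References: B. Mazur, J. Tate, J. Teitelbaum, Invent. Math. 84 (1986) Ch. I §17 [MazurTateTeitelbaum1986Invent]; L. Washington, GTM 83, §7.1
[Washington1997]; M. Goresky, Y.-S. Tai, arXiv:1701.07742, App. §16.2 Prop. 36 [GoreskyTai2017RealStructuresOrdinary]; K. Matsuno, IJNT 4 (2008)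
Prop. 6.4, Example 2 [Matsuno2008].
-/

set_option linter.dupNamespace false
set_option autoImplicit false

noncomputable section

open scoped Classical

namespace Summit.BirchSwinnertonDyer.BirchSwinnertonDyer.Theorems.AlignedTransportAtTwoHalfDescentTwistZero

open PowerSeries Literature.NumberTheory.EllipticCurves
  Literature.NumberTheory.EllipticCurves.IwasawaAlgebra
  Literature.Algebra.Polynomial.QPalindromicRealCounterpart
  Summit.BirchSwinnertonDyer.Rank1Residual.X1.MuLambda
  Summit.BirchSwinnertonDyer.Rank1Residual.Iwasawa
  Summit.BirchSwinnertonDyer.BirchSwinnertonDyer.Theorems.AlignedTransportAtTwoLayerValuePalindrome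
  Summit.BirchSwinnertonDyer.BirchSwinnertonDyer.Theorems.AlignedTransportAtTwoHalfDescent
  Summit.BirchSwinnertonDyer.BirchSwinnertonDyer.Theorems.AlignedTransportAtTwoHalfDescentValues

/-! ## §1 Reciprocal identities of odd degree vanish at `−2`; `T + 2` is `ι`-stable -/

section Algebra

variable {p : ℕ} [hp : Fact p.Prime]

/-- **A reciprocal identity of ODD degree forces a zero at `T = −2`**: if `Q_d(P) = ∑ a_k(−T)^k(1+T)^{d−k} = P` with `deg P ≤ d` odd, then `P(−2) = 0`
(`P(−2) = (−1)^d P(−2)` and `ℤ_p` has no `2`-torsion). Polynomial-level form of `…LayerValuePalindrome.eval_neg_two_weierstrassDistinguished_eq_zero_of_odd`.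
[cite: MazurTateTeitelbaum1986Invent, Ch. I §17] -/
theorem eval_neg_two_eq_zero_of_reciprocal_eq_of_odd {P : Polynomial ℤ_[p]} {d : ℕ} (hd : P.natDegree ≤ d) (hodd : Odd d)
    (hQ : (∑ k ∈ Finset.range (d + 1), Polynomial.C (P.coeff k) * (-Polynomial.X) ^ k * (1 + Polynomial.X) ^ (d - k)) = P) :
    P.eval (-2) = 0 := by
  have hev : P.eval (-2) = (-1) ^ d * P.eval (-2) := by
    conv_lhs => rw [← hQ]
    rw [Polynomial.eval_finsetSum, Polynomial.eval_eq_sum_range' (Nat.lt_succ_of_le hd), Finset.mul_sum]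
    refine Finset.sum_congr rfl fun k hk ↦ ?_
    rw [Finset.mem_range] at hk
    simp only [Polynomial.eval_mul, Polynomial.eval_C, Polynomial.eval_pow, Polynomial.eval_neg, Polynomial.eval_X, neg_neg,
      Polynomial.eval_add, Polynomial.eval_one]
    have h12 : ((1 : ℤ_[p]) + -2) = -1 := by norm_num
    have hsign : ((-1 : ℤ_[p])) ^ d = (-1) ^ (d - k) * (-1) ^ k := by rw [← pow_add, Nat.sub_add_cancel (Nat.le_of_lt_succ hk)]
    have hsq : ((-1 : ℤ_[p])) ^ k * (-1) ^ k = 1 := by rw [← pow_add, ← two_mul, pow_mul]; simp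
    rw [h12]
    calc P.coeff k * (2 : ℤ_[p]) ^ k * (-1) ^ (d - k) = P.coeff k * 2 ^ k * (-1) ^ (d - k) * ((-1) ^ k * (-1) ^ k) := by rw [hsq, mul_one]
      _ = ((-1) ^ (d - k) * (-1) ^ k) * (P.coeff k * ((-1) ^ k * 2 ^ k)) := by ring
      _ = (-1) ^ d * (P.coeff k * (-2) ^ k) := by rw [← hsign, ← neg_pow]
  rw [hodd.neg_one_pow, neg_one_mul, eq_neg_iff_add_eq_zero, add_self_eq_zero] at hev
  exact hev

/-- **`T + 2` is `ι`-stable**: `(1+T)·ι(T + 2) = T + 2` in `Λ` (`T = −2`, i.e. `γ = −1`, is the second fixed point of `γ ↦ γ⁻¹`).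
[cite: MazurTateTeitelbaum1986Invent, Ch. I §17] -/
theorem one_add_X_mul_invol_X_add_two : ((1 : IwasawaAlgebra p) + X) * invol p (X + 2) = X + 2 := by
  have hS : invol p PowerSeries.X * (1 + PowerSeries.X) = -PowerSeries.X := invol_X_mul_one_add_X p
  rw [map_add, map_ofNat]
  linear_combination hS

/-- The polynomial `T + 2` coerces to the power series `T + 2`. [folklore] -/
theorem coe_X_add_C_two : (((Polynomial.X + Polynomial.C 2 : Polynomial ℤ_[p])) : IwasawaAlgebra p) = X + 2 := by
  rw [Polynomial.coe_add, Polynomial.coe_X, Polynomial.coe_C, map_ofNat]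

/-- **Peeling off the twist zero keeps `ι`-palindromicity**: `(1+T)^d·ι(P) = P`, `P = (T+2)^k·P'`, `k ≤ d` ⟹ `(1+T)^{d−k}·ι(P') = P'`
(`Λ` is a domain). [cite: MazurTateTeitelbaum1986Invent, Ch. I §17] -/
theorem invol_of_eq_X_add_two_pow_mul {P P' : Polynomial ℤ_[p]} {d k : ℕ} (hk : k ≤ d) (hP : P = (Polynomial.X + Polynomial.C 2) ^ k * P')
    (hι : ((1 : IwasawaAlgebra p) + X) ^ d * invol p (P : IwasawaAlgebra p) = (P : IwasawaAlgebra p)) :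
    ((1 : IwasawaAlgebra p) + X) ^ (d - k) * invol p (P' : IwasawaAlgebra p) = (P' : IwasawaAlgebra p) := by
  set L : IwasawaAlgebra p := X + 2 with hL
  have hLι : ((1 : IwasawaAlgebra p) + X) * invol p L = L := one_add_X_mul_invol_X_add_two
  have hLne : L ≠ 0 := by
    rw [hL, ← coe_X_add_C_two, Ne, ← Polynomial.coe_zero, Polynomial.coe_inj]
    exact (Polynomial.monic_X_add_C 2).ne_zero
  have hPc : (P : IwasawaAlgebra p) = L ^ k * (P' : IwasawaAlgebra p) := by
    rw [hP, Polynomial.coe_mul, Polynomial.coe_pow, coe_X_add_C_two]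
  rw [hPc, map_mul, map_pow] at hι
  have hsplit : ((1 : IwasawaAlgebra p) + X) ^ d = (1 + X) ^ k * (1 + X) ^ (d - k) := by rw [← pow_add, Nat.add_sub_cancel' hk]
  have h1 : L ^ k * (((1 : IwasawaAlgebra p) + X) ^ (d - k) * invol p (P' : IwasawaAlgebra p)) = L ^ k * (P' : IwasawaAlgebra p) := by
    calc L ^ k * (((1 : IwasawaAlgebra p) + X) ^ (d - k) * invol p (P' : IwasawaAlgebra p))
        = ((1 + X) * invol p L) ^ k * ((1 + X) ^ (d - k) * invol p (P' : IwasawaAlgebra p)) := by rw [hLι]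
      _ = (1 + X) ^ k * (1 + X) ^ (d - k) * ((invol p L) ^ k * invol p (P' : IwasawaAlgebra p)) := by rw [mul_pow]; ring
      _ = L ^ k * (P' : IwasawaAlgebra p) := by rw [← hsplit, hι]
  exact mul_left_cancel₀ (pow_ne_zero k hLne) h1

end Algebra

/-! ## §2 The structure theorem with the twist zero -/

section Structure

variable {p : ℕ} [hp : Fact p.Prime]

/-- ★★★ **THE HALF-DEGREE DESCENT WITH THE TWIST ZERO (no parity hypothesis).** `F ∈ Λ = ℤ_p⟦T⟧`, `F ≢ 0 (mod p)`, `F(0) ≠ 0`, `ι F = u·F`; `P` its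
distinguished polynomial, `λ = deg P`, `k := ord_{T=−2} P` (the root multiplicity at `−2`). Then **`λ = k + 2m`** for some `m` and there is a monic
`h ∈ ℤ_p[Y]` of degree `m` with **`P = (T + 2)^k · ∑_{j ≤ m} b_j (1+T)^{m−j}((1+T)² + 1)^j`** (`= (T+2)^k (1+T)^m h(γ + γ⁻¹)`), the cofactor
`P' = P/(T+2)^k` having `P'(−2) ≠ 0` and `P'(X − 1) = ∑ b_j X^{m−j}(X²+1)^j`. [cite: GoreskyTai2017RealStructuresOrdinary, App. §16.2 Prop. 36 (p0036)]
[cite: MazurTateTeitelbaum1986Invent, Ch. I §17] [cite: Washington1997, §7.1 (Weierstrass preparation, uniqueness)] -/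
theorem exists_twistZero_realCounterpart {F : IwasawaAlgebra p} (hred : F.map (IsLocalRing.residue ℤ_[p]) ≠ 0)
    (h0 : PowerSeries.constantCoeff F ≠ 0) (hι : ∃ u : (IwasawaAlgebra p)ˣ, invol p F = u * F) :
    ∃ (m : ℕ) (h : Polynomial ℤ_[p]),
      (F.weierstrassDistinguished hred).natDegree = (F.weierstrassDistinguished hred).rootMultiplicity (-2) + 2 * m ∧
      h.Monic ∧ h.natDegree = m ∧
      ((F.weierstrassDistinguished hred) /ₘ (Polynomial.X + Polynomial.C 2) ^ (F.weierstrassDistinguished hred).rootMultiplicity (-2)).comp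
          (Polynomial.X - Polynomial.C 1) =
        ∑ j ∈ Finset.range (m + 1), Polynomial.C (h.coeff j) * Polynomial.X ^ (m - j) * (Polynomial.X ^ 2 + Polynomial.C 1) ^ j ∧
      F.weierstrassDistinguished hred = (Polynomial.X + Polynomial.C 2) ^ (F.weierstrassDistinguished hred).rootMultiplicity (-2) *
        ∑ j ∈ Finset.range (m + 1), Polynomial.C (h.coeff j) * (Polynomial.X + Polynomial.C 1) ^ (m - j) *
          ((Polynomial.X + Polynomial.C 1) ^ 2 + Polynomial.C 1) ^ j := by
  set P : Polynomial ℤ_[p] := F.weierstrassDistinguished hred with hP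
  set k : ℕ := P.rootMultiplicity (-2) with hk
  set P' : Polynomial ℤ_[p] := P /ₘ (Polynomial.X + Polynomial.C 2) ^ k with hP'
  have hPd : P.IsDistinguishedAt (IsLocalRing.maximalIdeal ℤ_[p]) := F.isDistinguishedAt_weierstrassDistinguished hred
  have hPne : P ≠ 0 := hPd.monic.ne_zero
  have hXC : (Polynomial.X + Polynomial.C (2 : ℤ_[p])) = Polynomial.X - Polynomial.C (-2) := by rw [map_neg, sub_neg_eq_add]
  have hfac : P = (Polynomial.X + Polynomial.C 2) ^ k * P' := by
    rw [hP', hk, hXC]; exact (Polynomial.pow_mul_divByMonic_rootMultiplicity_eq P (-2)).symm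
  have hP'2 : P'.eval (-2) ≠ 0 := by
    rw [hP', hk, hXC]; exact Polynomial.eval_divByMonic_pow_rootMultiplicity_ne_zero (-2) hPne
  have hmonL : ((Polynomial.X + Polynomial.C (2 : ℤ_[p])) ^ k).Monic := (Polynomial.monic_X_add_C 2).pow k
  have hdegL : ((Polynomial.X + Polynomial.C (2 : ℤ_[p])) ^ k).natDegree = k := by
    rw [Polynomial.natDegree_pow, Polynomial.natDegree_X_add_C, mul_one]
  have hP'ne : P' ≠ 0 := fun h0' ↦ hP'2 (by rw [h0', Polynomial.eval_zero])
  have hdeg : P.natDegree = k + P'.natDegree := by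
    conv_lhs => rw [hfac]
    rw [Polynomial.Monic.natDegree_mul' hmonL hP'ne, hdegL]
  have hkle : k ≤ P.natDegree := by rw [hdeg]; exact Nat.le_add_right _ _
  -- `ι`-palindromicity of `P` and of the cofactor `P'`
  obtain ⟨-, hkey⟩ := eval_neg_one_and_invol_weierstrassDistinguished hred h0 hι
  rw [← hP] at hkey
  have hι' := invol_of_eq_X_add_two_pow_mul hkle hfac hkey
  have hd' : P.natDegree - k = P'.natDegree := by rw [hdeg, Nat.add_sub_cancel_left]
  rw [hd'] at hι'
  have hQ' := reciprocal_eq_of_invol le_rfl hι'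
  -- the cofactor has even degree
  have heven : Even P'.natDegree := by
    by_contra hodd
    rw [Nat.not_even_iff_odd] at hodd
    exact hP'2 (eval_neg_two_eq_zero_of_reciprocal_eq_of_odd le_rfl hodd hQ')
  obtain ⟨m, hm⟩ := heven
  have hm2 : P'.natDegree = 2 * m := by rw [hm, two_mul]
  rw [hm2] at hQ'
  obtain ⟨h, hn, hPh⟩ := exists_eq_transform_of_reciprocal_eq hm2.le hQ'
  -- `h` is monic of degree `m` (the cofactor is monic of degree `2m`)
  have hmonP' : P'.Monic := by
    have hlc := congrArg Polynomial.leadingCoeff hfac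
    rw [Polynomial.leadingCoeff_mul' (by rw [hmonL.leadingCoeff, one_mul]; exact Polynomial.leadingCoeff_ne_zero.mpr hP'ne),
      hmonL.leadingCoeff, one_mul, hPd.monic.leadingCoeff] at hlc
    exact hlc.symm
  have hmonc : (P'.comp (Polynomial.X - Polynomial.C 1)).Monic :=
    hmonP'.comp (Polynomial.monic_X_sub_C 1) (by rw [Polynomial.natDegree_X_sub_C]; exact one_ne_zero)
  have hdegc : (P'.comp (Polynomial.X - Polynomial.C 1)).natDegree = 2 * m := by
    rw [Polynomial.natDegree_comp, Polynomial.natDegree_X_sub_C, mul_one, hm2]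
  obtain ⟨hmon, hdegh⟩ := (monic_iff_of_eq_transform 1 m hn hPh).mpr ⟨hmonc, hdegc⟩
  refine ⟨m, h, by rw [hdeg, hm2], hmon, hdegh, hPh, ?_⟩
  conv_lhs => rw [hfac]
  rw [eq_transform_comp_X_add_one hPh]

/-- **Uniqueness of `h` given the twist-zero factorisation**: `(T+2)^k · 𝒯(h₁)(T+1) = (T+2)^k · 𝒯(h₂)(T+1)`, `deg h_i ≤ m` ⟹ `h₁ = h₂`.
[cite: GoreskyTai2017RealStructuresOrdinary, App. §16.2 proof of Prop. 36 «the lower half of the matrix A is nonsingular» (p0036)] -/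
theorem realCounterpart_unique_of_twistZero {h₁ h₂ : Polynomial ℤ_[p]} {m k : ℕ} (hn₁ : h₁.natDegree ≤ m) (hn₂ : h₂.natDegree ≤ m)
    (heq : (Polynomial.X + Polynomial.C (2 : ℤ_[p])) ^ k *
        ∑ j ∈ Finset.range (m + 1), Polynomial.C (h₁.coeff j) * (Polynomial.X + Polynomial.C 1) ^ (m - j) *
          ((Polynomial.X + Polynomial.C 1) ^ 2 + Polynomial.C 1) ^ j =
      (Polynomial.X + Polynomial.C (2 : ℤ_[p])) ^ k *
        ∑ j ∈ Finset.range (m + 1), Polynomial.C (h₂.coeff j) * (Polynomial.X + Polynomial.C 1) ^ (m - j) *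
          ((Polynomial.X + Polynomial.C 1) ^ 2 + Polynomial.C 1) ^ j) : h₁ = h₂ := by
  have hne : (Polynomial.X + Polynomial.C (2 : ℤ_[p])) ^ k ≠ 0 := pow_ne_zero k (Polynomial.monic_X_add_C 2).ne_zero
  have h1 := mul_left_cancel₀ hne heq
  -- compose with `X − 1` to return to the transform
  have h2 := congrArg (fun q : Polynomial ℤ_[p] ↦ q.comp (Polynomial.X - Polynomial.C 1)) h1
  simp only [Polynomial.sum_comp, Polynomial.mul_comp, Polynomial.C_comp, Polynomial.pow_comp, Polynomial.add_comp, Polynomial.X_comp,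
    sub_add_cancel] at h2
  exact transform_injective 1 m hn₁ hn₂ h2

/-- ★★ **The value law with the twist zero**: `P = (T+2)^k · 𝒯(h)(T+1)` ⟹ **`P(x − 1) = (x + 1)^k · x^m · h(x + x⁻¹)`** for every unit `x` of every
`ℤ_p`-algebra (so `|F(ζ−1)| = p^{−μ}|ζ + 1|^k|h(ζ + ζ⁻¹)|`; for `2`-power roots of unity `ζ ≠ ±1`, `|ζ + 1| = |ζ − 1|`).
[cite: GoreskyTai2017RealStructuresOrdinary, App. §16.2 «p(x) = xⁿ h(x + q/x)» (p0036)] -/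
theorem eval₂_sub_one_eq_of_twistZero {S : Type*} [CommRing S] (f : ℤ_[p] →+* S) {P h : Polynomial ℤ_[p]} {m k : ℕ} (hn : h.natDegree ≤ m)
    (hP : P = (Polynomial.X + Polynomial.C 2) ^ k *
      ∑ j ∈ Finset.range (m + 1), Polynomial.C (h.coeff j) * (Polynomial.X + Polynomial.C 1) ^ (m - j) *
        ((Polynomial.X + Polynomial.C 1) ^ 2 + Polynomial.C 1) ^ j) (x : Sˣ) :
    P.eval₂ f ((x : S) - 1) = ((x : S) + 1) ^ k * ((x : S) ^ m * h.eval₂ f ((x : S) + (x⁻¹ : Sˣ))) := by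
  set T : Polynomial ℤ_[p] := ∑ j ∈ Finset.range (m + 1), Polynomial.C (h.coeff j) * (Polynomial.X + Polynomial.C 1) ^ (m - j) *
    ((Polynomial.X + Polynomial.C 1) ^ 2 + Polynomial.C 1) ^ j with hT
  have hTc : T.comp (Polynomial.X - Polynomial.C 1) =
      ∑ j ∈ Finset.range (m + 1), Polynomial.C (h.coeff j) * Polynomial.X ^ (m - j) * (Polynomial.X ^ 2 + Polynomial.C 1) ^ j := by
    rw [hT]
    simp only [Polynomial.sum_comp, Polynomial.mul_comp, Polynomial.C_comp, Polynomial.pow_comp, Polynomial.add_comp, Polynomial.X_comp,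
      sub_add_cancel]
  have hval := eval₂_sub_one_eq f hn hTc x
  rw [hP, Polynomial.eval₂_mul, Polynomial.eval₂_pow, Polynomial.eval₂_add, Polynomial.eval₂_X, Polynomial.eval₂_C, map_ofNat, hval]
  congr 2
  ring

/-- ★★ **In `Λ`: `P = (T+2)^k · (1+T)^m · h(γ + γ⁻¹)`.** [cite: MazurTateTeitelbaum1986Invent, Ch. I §17] [cite: GoreskyTai2017RealStructuresOrdinary, App. §16.2 (p0036)] -/
theorem coe_eq_of_twistZero {P h : Polynomial ℤ_[p]} {m k : ℕ} (hn : h.natDegree ≤ m)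
    (hP : P = (Polynomial.X + Polynomial.C 2) ^ k *
      ∑ j ∈ Finset.range (m + 1), Polynomial.C (h.coeff j) * (Polynomial.X + Polynomial.C 1) ^ (m - j) *
        ((Polynomial.X + Polynomial.C 1) ^ 2 + Polynomial.C 1) ^ j) :
    (P : IwasawaAlgebra p) = ((X : IwasawaAlgebra p) + 2) ^ k *
      (((1 : IwasawaAlgebra p) + X) ^ m * Polynomial.aeval (((1 : IwasawaAlgebra p) + X) + invol p (1 + X)) h) := by
  set T : Polynomial ℤ_[p] := ∑ j ∈ Finset.range (m + 1), Polynomial.C (h.coeff j) * (Polynomial.X + Polynomial.C 1) ^ (m - j) *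
    ((Polynomial.X + Polynomial.C 1) ^ 2 + Polynomial.C 1) ^ j with hT
  have hTc : T.comp (Polynomial.X - Polynomial.C 1) =
      ∑ j ∈ Finset.range (m + 1), Polynomial.C (h.coeff j) * Polynomial.X ^ (m - j) * (Polynomial.X ^ 2 + Polynomial.C 1) ^ j := by
    rw [hT]
    simp only [Polynomial.sum_comp, Polynomial.mul_comp, Polynomial.C_comp, Polynomial.pow_comp, Polynomial.add_comp, Polynomial.X_comp,
      sub_add_cancel]
  rw [hP, Polynomial.coe_mul, Polynomial.coe_pow, coe_X_add_C_two, coe_eq_one_add_X_pow_mul_aeval hn hTc]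

/-- ★★★ **`F = p^{μ(F)} · (T+2)^k · h(γ + γ⁻¹) · w`, `w ∈ Λˣ`** — the characteristic element of ANY `ι`-stable `F ≠ 0` with `F(0) ≠ 0`: three
invariants `μ`, `k = ord_{T=−2}` (at `p = 2` the order of the `χ₈`-twist zero; `0` at odd `p`) and the real counterpart `h` (monic, `λ = k + 2 deg h`).
[cite: MazurTateTeitelbaum1986Invent, Ch. I §17] [cite: Washington1997, §7.1 (Weierstrass preparation, uniqueness)] -/
theorem exists_eq_C_pow_mu_mul_X_add_two_pow_mul_aeval_mul_unit {F : IwasawaAlgebra p} (hF : F ≠ 0) (h0 : PowerSeries.constantCoeff F ≠ 0)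
    (hι : ∃ u : (IwasawaAlgebra p)ˣ, invol p F = u * F) :
    ∃ (k m : ℕ) (h : Polynomial ℤ_[p]) (w : (IwasawaAlgebra p)ˣ), lam F = k + 2 * m ∧ h.Monic ∧ h.natDegree = m ∧
      F = PowerSeries.C ((p : ℤ_[p]) ^ mu F) * ((X : IwasawaAlgebra p) + 2) ^ k *
        Polynomial.aeval (((1 : IwasawaAlgebra p) + X) + invol p (1 + X)) h * w := by
  set G := pfree F with hG
  have hred : G.map (IsLocalRing.residue ℤ_[p]) ≠ 0 := red_pfree_ne_zero hF
  have h0' : PowerSeries.constantCoeff G ≠ 0 := fun h ↦ h0 (by rw [eq_C_pow_mu_mul_pfree F, map_mul, ← hG, h, mul_zero])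
  obtain ⟨m, h, hlam, hmon, hn, -, hPfac⟩ := exists_twistZero_realCounterpart hred h0' (invol_pfree hι)
  have hfac : G = (G.weierstrassDistinguished hred : IwasawaAlgebra p) * G.weierstrassUnit hred :=
    G.eq_weierstrassDistinguished_mul_weierstrassUnit hred
  have hU : IsUnit (G.weierstrassUnit hred) := G.isUnit_weierstrassUnit hred
  have h1X : IsUnit (((1 : IwasawaAlgebra p) + X) ^ m) := by
    refine IsUnit.pow m ?_
    rw [PowerSeries.isUnit_iff_constantCoeff, map_add, map_one, constantCoeff_X, add_zero]
    exact isUnit_one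
  refine ⟨(G.weierstrassDistinguished hred).rootMultiplicity (-2), m, h, (h1X.mul hU).unit, ?_, hmon, hn, ?_⟩
  · rw [lam_eq_natDegree_weierstrassDistinguished (eq_C_pow_mu_mul_pfree F) hred]; exact hlam
  · rw [IsUnit.unit_spec]
    conv_lhs => rw [eq_C_pow_mu_mul_pfree F, ← hG, hfac, coe_eq_of_twistZero hn.le hPfac]
    ring

/-- **At odd `p` there is no twist zero**: `T + 2` is a unit direction — a distinguished `P` has `P(−2) ≡ (−2)^{deg P} ≢ 0 (mod p)`, so `ord_{−2} P = 0`.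
[cite: Washington1997, §7.1] -/
theorem rootMultiplicity_neg_two_eq_zero_of_odd_prime (hp2 : p ≠ 2) {P : Polynomial ℤ_[p]} (hPd : P.IsDistinguishedAt (IsLocalRing.maximalIdeal ℤ_[p])) :
    P.rootMultiplicity (-2) = 0 := by
  rw [Polynomial.rootMultiplicity_eq_zero_iff, Polynomial.IsRoot.def]
  intro hzero
  exfalso
  set d := P.natDegree with hd
  have hmem : P.eval (-2) - (-2) ^ d ∈ IsLocalRing.maximalIdeal ℤ_[p] := by
    rw [Polynomial.eval_eq_sum_range, ← hd, Finset.sum_range_succ, hPd.monic.coeff_natDegree, one_mul, add_sub_cancel_right]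
    refine Ideal.sum_mem _ fun k hk ↦ Ideal.mul_mem_right _ _ (hPd.mem ?_)
    rw [Finset.mem_range] at hk; rw [← hd]; exact hk
  rw [hzero, zero_sub] at hmem
  have h2 : IsUnit (2 : ℤ_[p]) := by
    rw [PadicInt.isUnit_iff]
    refine le_antisymm (PadicInt.norm_le_one _) (not_lt.mp fun hlt ↦ hp2 ?_)
    have h := (PadicInt.norm_int_lt_one_iff_dvd (p := p) 2).mp (by exact_mod_cast hlt)
    have h' : p ∣ 2 := by exact_mod_cast h
    exact (Nat.prime_dvd_prime_iff_eq hp.out Nat.prime_two).mp h'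
  exact (IsLocalRing.maximalIdeal.isMaximal ℤ_[p]).ne_top (Ideal.eq_top_of_isUnit_mem _ hmem ((h2.neg.pow d).neg))

end Structure

end Summit.BirchSwinnertonDyer.BirchSwinnertonDyer.Theorems.AlignedTransportAtTwoHalfDescentTwistZero

end
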